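import Summits.QuantumFields.YangMills.Theorems.VirialFluxGapScalingTauber
import Summits.QuantumFields.YangMills.Theorems.VirialFluxGapDeficitForm
import Summits.QuantumFields.YangMills.Theorems.VirialFluxGapSharpTwistedLaplaceWindowArithmetic
import Summits.QuantumFields.YangMills.Theses.VirialFluxGap
import HarnessLib

/-!
# Route `VirialFluxGap` (YangMills): `PeriodicSoftness` ⇐ a ONE-SIDED VOLUME SCALING LAW of the toron valley (+ a small-ball floor)

The deciding crux `VirialFluxGap.PeriodicSoftness` (item stmt-QuantumFields-24141, the LAST open leaf of the route after ✓⟨24204⟩ /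
✓⟨24142⟩) asks `β·(log W₀)′(β) ≥ 12βL⁴ − 9L⁴ + c` on Laplace windows `L₀ ≤ L ≤ β^a`, i.e. (✓`RingDeficit.deficitFormZero`) the Gibbs mean of
the zero-flux ring deficit obeys `β⟨F₀⟩_β ≤ 9L⁴ − c`.  The registered hearts are TWO-SIDED power-log small-ball laws of the toron valley
(`stub_periodicVolumeLaw` of LINE «tauber-mean»; ⟨stmt-QuantumFields-24497⟩ `ToronTubeVolumeLaw` of sub-route `ToronValleyVolume`, OPEN, L).
This file records that a ONE-SIDED, constant-free input suffices:

* ★ `periodicSoftness_of_volumeScaling` — IF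
  (FLOOR) `∃ A > 0, r ≥ 0, L₀: ∀ L ≥ L₀, ∀ t ∈ (0,1]: exp(−A·L^r·(1 + log t⁻¹)) ≤ m₀(t)`, with `m₀(t) = μ_L{F₀ ≤ t}` the ring-measure volume of
  the sublevel set of the zero-flux deficit `F₀ = RingDeficit.ringDeficit L 0` (a polynomial-entropy small-ball floor: `{F₀ ≤ t}` contains a
  product of Haar balls of radius `√t/poly(L)` around the trivial history), and
  (SCALING) `∃ c > 0, K > 0, p ≥ 0, L₀: ∀ L ≥ L₀, ∀ t ∈ (0,(KL^p)⁻¹], ∀ θ ∈ (0,1]: θ^{9L⁴ − c}·m₀(t) ≤ m₀(θt)` — the sublevel volumes of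
  the periodic deficit DECAY NO FASTER THAN `t^{9L⁴−c}` at polynomial scale (equivalently `t ↦ t^{−(9L⁴−c)} m₀(t)` is non-increasing on
  `(0,(KL^p)⁻¹]`: the toron valley has SCALING CODIMENSION `≤ 18L⁴ − 2c`; prediction `18L⁴ − 3` from the `U(1)` stabiliser excess and the
  quartic commutator cone of the four `su(2)` zero modes, whose half-Euler field has divergence `6`),
  THEN `Summit.QuantumFields.YangMills.Theses.VirialFluxGap.PeriodicSoftness` holds (with softness constant `min(c,1)/2` and window
  `a = 1/(4(p+r+5))`).

Proof: ✓`ScalingTauber.scalingTauber` (Chebyshev association against the Gamma weight whose first moment vanishes) at `α = 9L⁴ − c′`,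
`c′ = min(c,1)`, `ε = c′/2`, `t₀ = (K′L^p)⁻¹` (`K′ = max(K,1)`), floor `m₁ = exp(−AL^r(1 + log(K′L^p)))`; the threshold
`(βt₀+1)(βt₀)^α e^{2−βt₀} ≤ εm₁` is the window arithmetic `K′L^p·(10L⁴ log β + 3 + log(2/c′) + AL^r(1 + log(K′L^p))) ≤ β`
(`window_threshold`: monomials `L^s ≤ β^{1/2}` and `log β ≤ 4β^{1/4}` on `L ≤ β^a`); then ✓`deficitFormZero` converts `β⟨F₀⟩ ≤ 9L⁴ − c′/2`
into the route inequality.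

WHY THIS IS A DIFFERENT (WEAKER) HEART: no asymptotic law, no log factor / RLCT multiplicity, no constants `v, e, c`, no `t^θ`-uniformity are
asked — only a monotonicity at ONE polynomial scale and a crude floor.  The scaling law is what the flow of an EULER-TYPE vector field `V` on
`{F₀ < t₀}` yields (`V·∇F₀ ≥ 2(1 − o(L⁻⁴))F₀`, `div V ≤ 18L⁴ − 2c`: half-Euler on the 12 constant modes near the cone point — exact for the
homogeneous quartic `Σ_{μ<ν}‖[c_μ,c_ν]‖²` — and the Morse–Bott Euler field along the regular valley; patching term `½sχ′(s) ≤ 0`).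

HONEST FRAMING: a REDUCTION (helper) — the two hypotheses are NOT proved here; ⟨24141⟩, the route and every summit statement stay OPEN;
the Yang–Mills mass gap is NOT proved.  THEOREMS ONLY (0 `def`, 0 `sorry`), standard axioms.  Width seat `ym-line-sfw-p2-w2` g51
(cell ym-idea-1, free hands), `--supports stmt-QuantumFields-24141`.  References: [cite: Griffiths1964]; [cite: TomboulisYaffe1985];
[cite: MontvayMunster1994, (3.145)].
-/

set_option autoImplicit false

noncomputable section

open MeasureTheory Set Filter Real
open scoped Topology
open Summit.QuantumFields.YangMills.Theorems.VirialFluxGap.ScalingTauber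
open Summit.QuantumFields.YangMills.Theorems.VirialFluxGap.RingDeficit
open Summit.QuantumFields.YangMills.Theorems.VirialFluxGapSharpTwistedLaplaceWindow (le_rpow_half_of_sq_le)

namespace Summit.QuantumFields.YangMills.Theorems.VirialFluxGap.VolumeScaling

/-! ## §1 Window arithmetic -/

/-- ★ **Window threshold**: with `a = 1/(4(p+r+5))`, for `β ≥ β₀` and `1 ≤ L ≤ β^a`,
`K′L^p·(10L⁴ log β + 3 + log(2/c′) + A L^r (1 + log(K′L^p))) ≤ β` and `2 ≤ β`. [folklore] -/
theorem window_threshold {K' A p r c' : ℝ} (hK' : 1 ≤ K') (hA : 0 < A) (hp : 0 ≤ p) (hr : 0 ≤ r) (hc'0 : 0 < c') (hc'1 : c' ≤ 1) :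
    ∃ a : ℝ, 0 < a ∧ ∃ β₀ : ℝ, ∀ β : ℝ, β₀ ≤ β → ∀ L : ℕ, 1 ≤ L → (L : ℝ) ≤ β ^ a →
      2 ≤ β ∧
      K' * (L : ℝ) ^ p * (10 * (L : ℝ) ^ 4 * Real.log β + 3 + Real.log (2 / c') +
        A * (L : ℝ) ^ r * (1 + Real.log (K' * (L : ℝ) ^ p))) ≤ β := by
  obtain ⟨a, ha0, hadef⟩ : ∃ a : ℝ, 0 < a ∧ a = 1 / (4 * (p + r + 5)) := ⟨_, by positivity, rfl⟩
  have ha1 : a * (p + 4) ≤ 1 / 4 := by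
    rw [hadef, div_mul_eq_mul_div, one_mul, div_le_iff₀ (by positivity)]; nlinarith
  have ha2 : a * (p + r + 1) ≤ 1 / 2 := by
    rw [hadef, div_mul_eq_mul_div, one_mul, div_le_iff₀ (by positivity)]; nlinarith
  have ha3 : a * p ≤ 1 / 2 := by
    rw [hadef, div_mul_eq_mul_div, one_mul, div_le_iff₀ (by positivity)]; nlinarith
  have hK'0 : 0 < K' := by linarith
  have hlogK' : 0 ≤ Real.log K' := Real.log_nonneg hK'
  have hlog2c : 0 ≤ Real.log (2 / c') := Real.log_nonneg (by rw [le_div_iff₀ hc'0]; linarith)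
  set C : ℝ := K' * (40 + 3 + Real.log (2 / c') + A * (1 + Real.log K' + p)) with hC
  have hC0 : 0 ≤ C := by positivity
  refine ⟨a, ha0, max 2 (C ^ 2), ?_⟩
  intro β hβ L hL hLβ
  have hβ2 : 2 ≤ β := le_trans (le_max_left _ _) hβ
  have hβC : C ^ 2 ≤ β := le_trans (le_max_right _ _) hβ
  have hβ1 : 1 ≤ β := by linarith
  have hβ0 : 0 < β := by linarith
  have hℓ1 : (1 : ℝ) ≤ L := by exact_mod_cast hL
  have hℓ0 : (0 : ℝ) < L := by linarith
  refine ⟨hβ2, ?_⟩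
  -- `β^{1/2}`
  have hHH : β ^ (1 / 2 : ℝ) * β ^ (1 / 2 : ℝ) = β := by
    rw [← Real.rpow_add hβ0]; norm_num
  have hHC : C ≤ β ^ (1 / 2 : ℝ) := le_rpow_half_of_sq_le hC0 hβC
  -- monomials in `L` are `≤ β^{exponent}`
  have hpow : ∀ s e : ℝ, 0 ≤ s → a * s ≤ e → (L : ℝ) ^ s ≤ β ^ e := by
    intro s e hs hse
    calc (L : ℝ) ^ s ≤ (β ^ a) ^ s := Real.rpow_le_rpow hℓ0.le hLβ hs
      _ = β ^ (a * s) := by rw [← Real.rpow_mul hβ0.le]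
      _ ≤ β ^ e := Real.rpow_le_rpow_of_exponent_le hβ1 hse
  have hnat : ∀ n : ℕ, (L : ℝ) ^ (n : ℝ) = (L : ℝ) ^ n := fun n => Real.rpow_natCast _ n
  have hR1 : 1 ≤ (L : ℝ) ^ p := Real.one_le_rpow hℓ1 hp
  have hR0 : 0 < (L : ℝ) ^ p := by positivity
  have hRr0 : 0 < (L : ℝ) ^ r := by positivity
  -- the logarithms
  have hlogβ : Real.log β ≤ 4 * β ^ (1 / 4 : ℝ) := by
    have h := Real.log_le_rpow_div hβ0.le (by norm_num : (0:ℝ) < 1 / 4)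
    calc Real.log β ≤ β ^ (1 / 4 : ℝ) / (1 / 4) := h
      _ = 4 * β ^ (1 / 4 : ℝ) := by ring
  have hlogβ0 : 0 ≤ Real.log β := Real.log_nonneg hβ1
  have hlogKL : Real.log (K' * (L : ℝ) ^ p) ≤ Real.log K' + p * (L : ℝ) := by
    rw [Real.log_mul hK'0.ne' hR0.ne', Real.log_rpow hℓ0]
    refine add_le_add le_rfl (mul_le_mul_of_nonneg_left ((Real.log_le_sub_one_of_pos hℓ0).trans (by linarith)) hp)
  -- (i) `K' L^p · 10 L⁴ log β ≤ 40 K' β^{1/2}`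
  have hp4 : (L : ℝ) ^ p * (L : ℝ) ^ 4 = (L : ℝ) ^ (p + 4) := by
    rw [Real.rpow_add hℓ0, show (4 : ℝ) = ((4 : ℕ) : ℝ) by norm_num, hnat]
  have h1 : K' * (L : ℝ) ^ p * (10 * (L : ℝ) ^ 4 * Real.log β) ≤ 40 * K' * β ^ (1 / 2 : ℝ) := by
    have hm : (L : ℝ) ^ (p + 4) ≤ β ^ (1 / 4 : ℝ) := hpow _ _ (by linarith) ha1
    have hq : (L : ℝ) ^ (p + 4) * Real.log β ≤ β ^ (1 / 4 : ℝ) * (4 * β ^ (1 / 4 : ℝ)) :=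
      mul_le_mul hm hlogβ hlogβ0 (Real.rpow_nonneg hβ0.le _)
    have hqq : β ^ (1 / 4 : ℝ) * β ^ (1 / 4 : ℝ) = β ^ (1 / 2 : ℝ) := by
      rw [← Real.rpow_add hβ0]; norm_num
    calc K' * (L : ℝ) ^ p * (10 * (L : ℝ) ^ 4 * Real.log β) = 10 * K' * ((L : ℝ) ^ p * (L : ℝ) ^ 4 * Real.log β) := by ring
      _ = 10 * K' * ((L : ℝ) ^ (p + 4) * Real.log β) := by rw [hp4]
      _ ≤ 10 * K' * (β ^ (1 / 4 : ℝ) * (4 * β ^ (1 / 4 : ℝ))) := mul_le_mul_of_nonneg_left hq (by positivity)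
      _ = 40 * K' * β ^ (1 / 2 : ℝ) := by rw [← hqq]; ring
  -- (ii) `K' L^p (3 + log(2/c')) ≤ K' (3 + log(2/c')) β^{1/2}`
  have h2 : K' * (L : ℝ) ^ p * (3 + Real.log (2 / c')) ≤ K' * (3 + Real.log (2 / c')) * β ^ (1 / 2 : ℝ) := by
    have hm : (L : ℝ) ^ p ≤ β ^ (1 / 2 : ℝ) := hpow _ _ hp ha3
    calc K' * (L : ℝ) ^ p * (3 + Real.log (2 / c')) = K' * (3 + Real.log (2 / c')) * (L : ℝ) ^ p := by ring
      _ ≤ K' * (3 + Real.log (2 / c')) * β ^ (1 / 2 : ℝ) := mul_le_mul_of_nonneg_left hm (by positivity)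
  -- (iii) `K' L^p · A L^r (1 + log(K' L^p)) ≤ K' A (1 + log K' + p) β^{1/2}`
  have h3 : K' * (L : ℝ) ^ p * (A * (L : ℝ) ^ r * (1 + Real.log (K' * (L : ℝ) ^ p))) ≤
      K' * (A * (1 + Real.log K' + p)) * β ^ (1 / 2 : ℝ) := by
    have hm : (L : ℝ) ^ (p + r + 1) ≤ β ^ (1 / 2 : ℝ) := hpow _ _ (by linarith) ha2
    have hsplit : (L : ℝ) ^ (p + r + 1) = (L : ℝ) ^ p * (L : ℝ) ^ r * (L : ℝ) := by
      rw [Real.rpow_add hℓ0, Real.rpow_add hℓ0, Real.rpow_one]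
    -- `1 + log(K'L^p) ≤ (1 + log K' + p) · L`
    have hin : 1 + Real.log (K' * (L : ℝ) ^ p) ≤ (1 + Real.log K' + p) * (L : ℝ) := by
      have e : (1 + Real.log K' + p) * (L : ℝ) = (L : ℝ) + Real.log K' * (L : ℝ) + p * (L : ℝ) := by ring
      rw [e]
      have f1 : Real.log K' ≤ Real.log K' * (L : ℝ) := le_mul_of_one_le_right hlogK' hℓ1
      linarith [hlogKL]
    have hin0 : 0 ≤ 1 + Real.log (K' * (L : ℝ) ^ p) := by
      have : 0 ≤ Real.log (K' * (L : ℝ) ^ p) := Real.log_nonneg (one_le_mul_of_one_le_of_one_le hK' hR1)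
      linarith
    calc K' * (L : ℝ) ^ p * (A * (L : ℝ) ^ r * (1 + Real.log (K' * (L : ℝ) ^ p)))
        = K' * A * ((L : ℝ) ^ p * (L : ℝ) ^ r) * (1 + Real.log (K' * (L : ℝ) ^ p)) := by ring
      _ ≤ K' * A * ((L : ℝ) ^ p * (L : ℝ) ^ r) * ((1 + Real.log K' + p) * (L : ℝ)) :=
          mul_le_mul_of_nonneg_left hin (by positivity)
      _ = K' * (A * (1 + Real.log K' + p)) * (L : ℝ) ^ (p + r + 1) := by rw [hsplit]; ring
      _ ≤ K' * (A * (1 + Real.log K' + p)) * β ^ (1 / 2 : ℝ) := mul_le_mul_of_nonneg_left hm (by positivity)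
  -- assemble
  calc K' * (L : ℝ) ^ p * (10 * (L : ℝ) ^ 4 * Real.log β + 3 + Real.log (2 / c') +
        A * (L : ℝ) ^ r * (1 + Real.log (K' * (L : ℝ) ^ p)))
      = K' * (L : ℝ) ^ p * (10 * (L : ℝ) ^ 4 * Real.log β) + K' * (L : ℝ) ^ p * (3 + Real.log (2 / c')) +
          K' * (L : ℝ) ^ p * (A * (L : ℝ) ^ r * (1 + Real.log (K' * (L : ℝ) ^ p))) := by ring
    _ ≤ 40 * K' * β ^ (1 / 2 : ℝ) + K' * (3 + Real.log (2 / c')) * β ^ (1 / 2 : ℝ) +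
          K' * (A * (1 + Real.log K' + p)) * β ^ (1 / 2 : ℝ) := add_le_add (add_le_add h1 h2) h3
    _ = C * β ^ (1 / 2 : ℝ) := by rw [hC]; ring
    _ ≤ β ^ (1 / 2 : ℝ) * β ^ (1 / 2 : ℝ) := mul_le_mul_of_nonneg_right hHC (by positivity)
    _ = β := hHH

/-! ## §2 The threshold of `scalingTauber` from the window arithmetic -/

/-- From `X ≥ P log β + 3 + log(2/c′) + B`, `3 ≤ X ≤ β`, `0 ≤ α`, `α + 1 ≤ P`: `(X+1)X^α e^{2−X} ≤ (c′/2)·e^{−B}`. [folklore] -/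
theorem threshold_of_window {X β α P c' B : ℝ} (hX3 : 3 ≤ X) (hXβ : X ≤ β) (hα0 : 0 ≤ α) (hαP : α + 1 ≤ P) (hc' : 0 < c')
    (hXge : P * Real.log β + 3 + Real.log (2 / c') + B ≤ X) :
    (X + 1) * X ^ α * Real.exp (2 - X) ≤ c' / 2 * Real.exp (-B) := by
  have hX0 : 0 < X := by linarith
  have hlogX0 : 0 ≤ Real.log X := Real.log_nonneg (by linarith)
  have hlogXβ : Real.log X ≤ Real.log β := Real.log_le_log hX0 hXβ
  -- `(X+1) X^α e^{2−X} = exp(log(X+1) + α log X + (2 − X))`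
  have hprod : (X + 1) * X ^ α * Real.exp (2 - X) = Real.exp (Real.log (X + 1) + α * Real.log X + (2 - X)) := by
    rw [Real.exp_add, Real.exp_add, Real.exp_log (by linarith : 0 < X + 1), Real.rpow_def_of_pos hX0, mul_comm (Real.log X) α]
  have hrhs : c' / 2 * Real.exp (-B) = Real.exp (Real.log (c' / 2) + -B) := by
    rw [Real.exp_add, Real.exp_log (by positivity : 0 < c' / 2)]
  rw [hprod, hrhs, Real.exp_le_exp]
  -- `log(X+1) ≤ 1 + log X`
  have hlog1 : Real.log (X + 1) ≤ 1 + Real.log X := by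
    have h2X : X + 1 ≤ 2 * X := by linarith
    have hlog2 : Real.log 2 ≤ 1 := by
      have := Real.log_le_sub_one_of_pos (by norm_num : (0:ℝ) < 2); linarith
    calc Real.log (X + 1) ≤ Real.log (2 * X) := Real.log_le_log (by linarith) h2X
      _ = Real.log 2 + Real.log X := Real.log_mul (by norm_num) hX0.ne'
      _ ≤ 1 + Real.log X := by linarith
  have hlog2c : Real.log (2 / c') = -Real.log (c' / 2) := by
    rw [← Real.log_inv, inv_div]
  -- `(α + 1) log X ≤ P log β`
  have hαlog : (α + 1) * Real.log X ≤ P * Real.log β :=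
    mul_le_mul hαP hlogXβ hlogX0 (by linarith)
  have e : Real.log (X + 1) + α * Real.log X + (2 - X) ≤ 1 + (α + 1) * Real.log X + (2 - X) := by nlinarith
  linarith

/-! ## §3 The reduction -/

/-- ★★★ **`PeriodicSoftness` from a one-sided volume scaling law of the toron valley (+ a small-ball floor)**: if the ring-measure volumes
`m₀(t)` of the sublevel sets of the zero-flux deficit satisfy the polynomial-entropy FLOOR `exp(−AL^r(1 + log t⁻¹)) ≤ m₀(t)` (`0 < t ≤ 1`) and
the MONOTONE SCALING LAW `θ^{9L⁴−c} m₀(t) ≤ m₀(θt)` (`0 < θ ≤ 1`, `0 < t ≤ (KL^p)⁻¹`) for `L ≥ L₀`, then the route decl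
`VirialFluxGap.PeriodicSoftness` holds.  A REDUCTION: the hypotheses are not proved here; no crux / rung / summit is proved; the YM mass
gap is NOT proved. [cite: Griffiths1964] [cite: MontvayMunster1994, (3.145)] -/
theorem periodicSoftness_of_volumeScaling
    (hfloor : ∃ A : ℝ, 0 < A ∧ ∃ r : ℝ, 0 ≤ r ∧ ∃ L₀ : ℕ, ∀ (L : ℕ) [NeZero L], L₀ ≤ L → ∀ t : ℝ, 0 < t → t ≤ 1 →
      Real.exp (-(A * (L : ℝ) ^ r * (1 + Real.log t⁻¹))) ≤
        (ringMeasure L).real {P | ringDeficit L (fun _ => false) P ≤ t})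
    (hscal : ∃ c : ℝ, 0 < c ∧ ∃ K : ℝ, 0 < K ∧ ∃ p : ℝ, 0 ≤ p ∧ ∃ L₀ : ℕ, ∀ (L : ℕ) [NeZero L], L₀ ≤ L →
      ∀ t : ℝ, 0 < t → t ≤ (K * (L : ℝ) ^ p)⁻¹ → ∀ θ : ℝ, 0 < θ → θ ≤ 1 →
        θ ^ (9 * (L : ℝ) ^ 4 - c) * (ringMeasure L).real {P | ringDeficit L (fun _ => false) P ≤ t} ≤
          (ringMeasure L).real {P | ringDeficit L (fun _ => false) P ≤ θ * t}) :
    Summit.QuantumFields.YangMills.Theses.VirialFluxGap.PeriodicSoftness := by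
  obtain ⟨A, hA, r, hr, L₁, hfl⟩ := hfloor
  obtain ⟨c, hc, K, hK, p, hp, L₂, hsc⟩ := hscal
  -- normalised constants
  set c' : ℝ := min c 1 with hc'
  have hc'0 : 0 < c' := lt_min hc one_pos
  have hc'1 : c' ≤ 1 := min_le_right _ _
  have hc'c : c' ≤ c := min_le_left _ _
  set K' : ℝ := max K 1 with hK'
  have hK'1 : 1 ≤ K' := le_max_right _ _
  have hK'K : K ≤ K' := le_max_left _ _
  have hK'0 : 0 < K' := by linarith
  obtain ⟨a, ha0, β₀, hwin⟩ := window_threshold (A := A) (p := p) (r := r) hK'1 hA hp hr hc'0 hc'1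
  refine ⟨a, ha0, c' / 2, by positivity, β₀, max (max L₁ L₂) 1, ?_⟩
  intro β hβ L _ hL hLβ
  have hL₁ : L₁ ≤ L := le_trans ((le_max_left _ _).trans (le_max_left _ _)) hL
  have hL₂ : L₂ ≤ L := le_trans ((le_max_right _ _).trans (le_max_left _ _)) hL
  have hL1 : 1 ≤ L := le_trans (le_max_right _ _) hL
  obtain ⟨hβ2, hT⟩ := hwin β hβ L hL1 hLβ
  have hβ0 : 0 < β := by linarith
  have hβ1 : 1 ≤ β := by linarith
  have hℓ1 : (1 : ℝ) ≤ L := by exact_mod_cast hL1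
  have hℓ0 : (0 : ℝ) < L := by linarith
  have hL4 : 1 ≤ (L : ℝ) ^ 4 := one_le_pow₀ hℓ1
  have hR1 : 1 ≤ (L : ℝ) ^ p := Real.one_le_rpow hℓ1 hp
  have hκ1 : 1 ≤ K' * (L : ℝ) ^ p := one_le_mul_of_one_le_of_one_le hK'1 hR1
  have hκ0 : 0 < K' * (L : ℝ) ^ p := by linarith
  -- the data of `scalingTauber`
  set t₀ : ℝ := (K' * (L : ℝ) ^ p)⁻¹ with ht₀
  have ht₀0 : 0 < t₀ := inv_pos.mpr hκ0
  have ht₀1 : t₀ ≤ 1 := inv_le_one_of_one_le₀ hκ1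
  have ht₀K : t₀ ≤ (K * (L : ℝ) ^ p)⁻¹ := by
    rw [ht₀]
    exact inv_anti₀ (by positivity) (mul_le_mul_of_nonneg_right hK'K (by positivity))
  set α : ℝ := 9 * (L : ℝ) ^ 4 - c' with hα
  have hα1 : 1 ≤ α := by rw [hα]; linarith
  set B : ℝ := A * (L : ℝ) ^ r * (1 + Real.log (K' * (L : ℝ) ^ p)) with hB
  set m₁ : ℝ := Real.exp (-B) with hm₁
  have hm₁0 : 0 < m₁ := Real.exp_pos _
  set X : ℝ := β * t₀ with hX
  -- `X = β / (K'L^p)`, `3 ≤ X ≤ β`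
  have hXge : 10 * (L : ℝ) ^ 4 * Real.log β + 3 + Real.log (2 / c') + B ≤ X := by
    rw [hX, ht₀, ← div_eq_mul_inv, le_div_iff₀ hκ0]
    calc (10 * (L : ℝ) ^ 4 * Real.log β + 3 + Real.log (2 / c') + B) * (K' * (L : ℝ) ^ p)
        = K' * (L : ℝ) ^ p * (10 * (L : ℝ) ^ 4 * Real.log β + 3 + Real.log (2 / c') +
            A * (L : ℝ) ^ r * (1 + Real.log (K' * (L : ℝ) ^ p))) := by rw [hB]; ring
      _ ≤ β := hT
  have hlogβ : 0 ≤ Real.log β := Real.log_nonneg hβ1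
  have hB0 : 0 ≤ B := by
    have : 0 ≤ Real.log (K' * (L : ℝ) ^ p) := Real.log_nonneg hκ1
    positivity
  have hlog2c : 0 ≤ Real.log (2 / c') := Real.log_nonneg (by rw [le_div_iff₀ hc'0]; linarith)
  have hX3 : 3 ≤ X := by
    have : 0 ≤ 10 * (L : ℝ) ^ 4 * Real.log β := by positivity
    linarith
  have hXβ : X ≤ β := by
    rw [hX]; exact mul_le_of_le_one_right hβ0.le ht₀1
  have hβt : 2 ≤ β * t₀ := by rw [← hX]; linarith
  -- the threshold
  have hthr : (β * t₀ + 1) * (β * t₀) ^ α * Real.exp (2 - β * t₀) ≤ c' / 2 * m₁ := by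
    rw [← hX, hm₁]
    exact threshold_of_window (P := 10 * (L : ℝ) ^ 4) hX3 hXβ (by linarith) (by rw [hα]; linarith) hc'0 hXge
  -- floor at `t₀`
  have hfloor' : m₁ ≤ (ringMeasure L).real {P | ringDeficit L (fun _ => false) P ≤ t₀} := by
    have h := hfl L hL₁ t₀ ht₀0 ht₀1
    rw [ht₀, inv_inv] at h
    rw [hm₁, hB, ht₀]
    exact h
  -- scaling law on `(0, t₀]` with exponent `α = 9L⁴ − c'`
  have hscal' : ∀ t : ℝ, 0 < t → t ≤ t₀ → ∀ θ : ℝ, 0 < θ → θ ≤ 1 →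
      θ ^ α * (ringMeasure L).real {P | ringDeficit L (fun _ => false) P ≤ t} ≤
        (ringMeasure L).real {P | ringDeficit L (fun _ => false) P ≤ θ * t} := by
    intro t ht htt θ hθ0 hθ1
    have h := hsc L hL₂ t ht (htt.trans ht₀K) θ hθ0 hθ1
    have hexp : θ ^ α ≤ θ ^ (9 * (L : ℝ) ^ 4 - c) :=
      Real.rpow_le_rpow_of_exponent_ge hθ0 hθ1 (by rw [hα]; linarith)
    exact (mul_le_mul_of_nonneg_right hexp measureReal_nonneg).trans h
  -- the Tauberian bound
  haveI := isProbabilityMeasure_ringMeasure (L := L)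
  obtain ⟨hmeas, hnn, hder⟩ := deficitFormZero L
  have htaub := scalingTauber (ringMeasure L) hmeas hnn hα1 ht₀0 hm₁0 (by positivity : 0 < c' / 2) hβ0 hβt
    hfloor' hscal' hthr
  rw [hder β hβ0]
  have : α + c' / 2 = 9 * (L : ℝ) ^ 4 - c' / 2 := by rw [hα]; ring
  linarith

end Summit.QuantumFields.YangMills.Theorems.VirialFluxGap.VolumeScaling

end
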